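import Literature.RingTheory.CompleteIntersection.Localization
import Literature.NumberTheory.Automorphic.HeckeCongruenceIdeal
import HarnessLib

/-!
# The local Hecke algebra `𝕋_𝔪` of an eigensystem and its congruence ideal

Companion to `Literature.NumberTheory.Automorphic.HeckeCongruenceIdeal`. For an `O`-valued Hecke
eigensystem `θ : 𝕋_ℤ →+* O` of `S_k(Γ₁(N))` with `O` a *local* ring (e.g. `O = 𝓞_{f,λ}` for a
newform `f` and a prime `λ` of its coefficient field), Darmon–Diamond–Taylor, *Fermat's Last
Theorem*, §4.1, attach to `θ` the maximal ideal `𝔪 = π_θ⁻¹(𝔪_O)` of `𝕋_O` (p. 108: normalised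
eigenforms over `k̄` ↔ maximal ideals of `𝕋_k` ↔ maximal primes of `𝕋_O`) and the localisation
`𝕋_𝔪` (p. 107: for complete `O`, "`𝕋_O → ∏_𝔪 𝕋_𝔪` is an isomorphism … each `𝕋_𝔪` is a complete
local `O`-algebra which is finitely generated and free as an `O`-module"), identified with the
reduced Hecke algebra `𝕋_Σ` in Prop. 4.7 (Diamond–Ribet, CSS 1997, Lemma 3.2); the augmentation
`π : 𝕋_Σ → O` of §3.3 (p. 96) and its congruence ideal `η_Σ = π(Ann_{𝕋_Σ}(ker π))` ((3.3.1)) live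
on this local algebra. Here:

* `eigenMaximalIdeal θ = 𝔪`, `LocalizedHeckeAlgebra θ = 𝕋_𝔪` (Mathlib `Localization.AtPrime`),
  `localizedEigenAugmentation θ : 𝕋_𝔪 →ₐ[O] O` (the unique extension of `π_θ`, from
  `Literature.RingTheory.CompleteIntersection.localizedAugmentation`);
* `eigenMaximalIdeal_eq_of_congruent`: `𝔪` depends only on the residual eigensystem
  `θ mod 𝔪_O` (congruent eigenforms share `𝔪`; op. cit. p. 108, (4.1.1));
* `heckeCongruenceIdeal_le_localized`, and **`heckeCongruenceIdeal_eq_localized`**: for `O`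
  Noetherian and `𝕋_ℤ` module-finite over `ℤ` (all weights `k ≥ 2`) the congruence ideal of
  `𝕋_𝔪 → O` (the printed `η` of (3.3.1)) equals `heckeCongruenceIdeal θ` computed on `𝕋_O`.

Not here: completeness of `𝕋_𝔪` and `𝕋_O ≅ ∏ 𝕋_𝔪` for complete `O`; `𝕋_Σ ≅ 𝕋_𝔪` (Prop. 4.7).

## References

* H. Darmon, F. Diamond, R. Taylor, *Fermat's Last Theorem*, Current Developments in Math.
  1995, §3.3 (p. 96, (3.3.1)), §4.1 (pp. 107–108), Prop. 4.7. [DarmonDiamondTaylor1995]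
* F. Diamond, K. A. Ribet, *ℓ-adic modular deformations and Wiles's "Main Conjecture"*, in:
  Modular Forms and Fermat's Last Theorem, Springer 1997, Lemma 3.2 (p. 362), p. 364.
  [DiamondRibet1997]
-/

noncomputable section

open scoped TensorProduct MatrixGroups ModularForm

open CongruenceSubgroup

namespace Literature.NumberTheory.Automorphic

open Literature.NumberTheory.EllipticCurves.ModularForms
open Literature.RingTheory.CompleteIntersection

/-! ### Local coefficient rings: `𝔪`, `𝕋_𝔪` and the localised augmentation -/

section Local

variable {N : ℕ} [NeZero N] {k : ℤ} {O : Type*} [CommRing O] [IsLocalRing O]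
  (θ : heckeRing1 N k →+* O)

/-- **The maximal ideal `𝔪 = 𝔪_θ = π_θ⁻¹(𝔪_O)` of `𝕋_O`** attached to the eigensystem `θ` over a
local `O`: the kernel of the residual eigensystem `𝕋_O → O → O/𝔪_O` (Darmon–Diamond–Taylor
§4.1, p. 108: eigenforms over `k̄` ↔ maximal ideals of `𝕋_k` ↔ maximal primes of `𝕋_O`;
Diamond–Ribet p. 362: "we write `𝕋_𝔪` for the completion of `𝕋` at the kernel `𝔪` of this
homomorphism"). [cite: DarmonDiamondTaylor1995, §4.1, p. 108] -/
abbrev eigenMaximalIdeal : Ideal (FullHeckeAlgebra N k O) :=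
  comapMaximalIdeal (T := FullHeckeAlgebra N k O) (eigenAugmentation θ)

/-- `𝔪_θ` is maximal. [folklore] -/
example : (eigenMaximalIdeal θ).IsMaximal := inferInstance

/-- `x ∈ 𝔪_θ ↔ π_θ x ∈ 𝔪_O`. [folklore] -/
theorem mem_eigenMaximalIdeal_iff {x : FullHeckeAlgebra N k O} :
    x ∈ eigenMaximalIdeal θ ↔ eigenAugmentation θ x ∈ IsLocalRing.maximalIdeal O :=
  Ideal.mem_comap

/-- `1 ⊗ T − a ⊗ 1 ∈ 𝔪_θ` whenever `θ(T) ≡ a mod 𝔪_O`: the maximal ideal only remembers the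
residual eigensystem `θ̄ : 𝕋_ℤ → O/𝔪_O` (Darmon–Diamond–Taylor §4.1, p. 108). [folklore] -/
theorem ofInt_sub_algebraMap_mem_eigenMaximalIdeal (T : heckeRing1 N k) {a : O}
    (h : θ T - a ∈ IsLocalRing.maximalIdeal O) :
    FullHeckeAlgebra.ofInt O T - algebraMap O (FullHeckeAlgebra N k O) a ∈
      eigenMaximalIdeal θ := by
  rw [mem_eigenMaximalIdeal_iff, map_sub, eigenAugmentation_ofInt, AlgHom.commutes,
    Algebra.algebraMap_self, RingHom.id_apply]
  exact h

/-- `𝔪_θ` is the kernel of the residual eigensystem `𝕋_O → O → O/𝔪_O`. [folklore] -/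
theorem eigenMaximalIdeal_eq_ker_residue :
    eigenMaximalIdeal θ =
      RingHom.ker ((IsLocalRing.residue O).comp (eigenAugmentation θ : FullHeckeAlgebra N k O →+* O)) :=
  comapMaximalIdeal_eq_ker_residue (T := FullHeckeAlgebra N k O) (eigenAugmentation θ)

/-- Two eigensystems that are congruent modulo `𝔪_O` have eigen-augmentations that are congruent
modulo `𝔪_O` on all of `𝕋_O`. [folklore] -/
theorem eigenAugmentation_sub_mem_maximalIdeal {θ₁ θ₂ : heckeRing1 N k →+* O}
    (h : ∀ T : heckeRing1 N k, θ₁ T - θ₂ T ∈ IsLocalRing.maximalIdeal O)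
    (x : FullHeckeAlgebra N k O) :
    eigenAugmentation θ₁ x - eigenAugmentation θ₂ x ∈ IsLocalRing.maximalIdeal O := by
  induction x using FullHeckeAlgebra.induction_on with
  | zero => simp
  | tmul a T =>
    rw [eigenAugmentation_tmul, eigenAugmentation_tmul, ← mul_sub]
    exact Ideal.mul_mem_left _ a (h T)
  | add x y hx hy =>
    rw [map_add, map_add, add_sub_add_comm]
    exact add_mem hx hy

/-- **The maximal ideal `𝔪` depends only on the residual eigensystem:** eigensystems `θ₁, θ₂`
with `θ₁(T) ≡ θ₂(T) mod 𝔪_O` for all `T ∈ 𝕋_ℤ` (i.e. congruent eigenforms, equivalently — for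
`T = T_p`, `⟨d⟩` — isomorphic residual Galois representations) have the same maximal ideal of
`𝕋_O` (Darmon–Diamond–Taylor §4.1, p. 108, diagram (4.1.1): normalised eigenforms mod `Gₖ`-conjugacy
over `k̄` ↔ maximal primes of `𝕋_O`; Lemma 4.6 / Diamond–Ribet p. 362: `𝔪` is attached to `ρ̄`).
[cite: DarmonDiamondTaylor1995, §4.1, p. 108, (4.1.1)] -/
theorem eigenMaximalIdeal_eq_of_congruent {θ₁ θ₂ : heckeRing1 N k →+* O}
    (h : ∀ T : heckeRing1 N k, θ₁ T - θ₂ T ∈ IsLocalRing.maximalIdeal O) :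
    eigenMaximalIdeal θ₁ = eigenMaximalIdeal θ₂ := by
  ext x
  rw [mem_eigenMaximalIdeal_iff, mem_eigenMaximalIdeal_iff]
  have hx := eigenAugmentation_sub_mem_maximalIdeal h x
  constructor
  · intro h1
    have := sub_mem h1 hx
    rwa [sub_sub_cancel] at this
  · intro h2
    have := add_mem hx h2
    rwa [sub_add_cancel] at this

/-- **The local Hecke algebra `𝕋_𝔪`**, the localisation of `𝕋_O` at `𝔪 = 𝔪_θ`
(Darmon–Diamond–Taylor §4.1, p. 107: "`𝕋_O → ∏_𝔪 𝕋_𝔪` … each `𝕋_𝔪` is a complete local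
`O`-algebra which is finitely generated and free as an `O`-module" for complete `O`; the
`𝕋_Σ ≅ 𝕋_𝔪` of Prop. 4.7 and of Diamond–Ribet Lemma 3.2). [cite: DarmonDiamondTaylor1995, §4.1, p. 107] -/
abbrev LocalizedHeckeAlgebra : Type _ :=
  Localization.AtPrime (R := FullHeckeAlgebra N k O) (eigenMaximalIdeal θ)

/-- **The augmentation `π : 𝕋_𝔪 →ₐ[O] O`** of the local Hecke algebra extending `π_θ` (the map
`π = π_f : 𝕋_Σ → O` of Darmon–Diamond–Taylor §3.3, p. 96, through `𝕋_Σ ≅ 𝕋_𝔪`, Prop. 4.7).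
[cite: DarmonDiamondTaylor1995, §3.3 p. 96 and Prop. 4.7] -/
abbrev localizedEigenAugmentation : LocalizedHeckeAlgebra θ →ₐ[O] O :=
  localizedAugmentation (T := FullHeckeAlgebra N k O) (eigenAugmentation θ)
    (LocalizedHeckeAlgebra θ)

/-- `π (x/1) = π_θ(x)`: the localised augmentation extends `π_θ`. [folklore] -/
theorem localizedEigenAugmentation_algebraMap (x : FullHeckeAlgebra N k O) :
    localizedEigenAugmentation θ (algebraMap (FullHeckeAlgebra N k O) (LocalizedHeckeAlgebra θ) x) =
      eigenAugmentation θ x :=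
  localizedAugmentation_algebraMap (T := FullHeckeAlgebra N k O) (eigenAugmentation θ) _ x

/-- The localised augmentation is surjective. [folklore] -/
theorem localizedEigenAugmentation_surjective :
    Function.Surjective (localizedEigenAugmentation θ) :=
  augmentation_surjective (T := LocalizedHeckeAlgebra θ) (localizedEigenAugmentation θ)

/-- The congruence ideal computed on `𝕋_𝔪` contains the one computed on `𝕋_O`. [folklore] -/
theorem heckeCongruenceIdeal_le_localized :
    heckeCongruenceIdeal θ ≤
      congruenceIdeal (T := LocalizedHeckeAlgebra θ) (localizedEigenAugmentation θ) :=
  congruenceIdeal_le_congruenceIdeal_localizedAugmentation (T := FullHeckeAlgebra N k O)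
    (eigenAugmentation θ) (LocalizedHeckeAlgebra θ)

/-- **The congruence ideal is insensitive to localisation at `𝔪`:** for `O` Noetherian local and
`𝕋_ℤ` module-finite over `ℤ` (all weights `k ≥ 2`), `η` computed on the local algebra `𝕋_𝔪`
(as printed in Darmon–Diamond–Taylor (3.3.1) and Diamond–Ribet p. 364) equals
`heckeCongruenceIdeal θ` computed on `𝕋_O`. [cite: DarmonDiamondTaylor1995, (3.3.1) with §4.1–4.2] -/
theorem heckeCongruenceIdeal_eq_localized [IsNoetherianRing O]
    [Module.Finite ℤ (heckeRing1 N k)] :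
    congruenceIdeal (T := LocalizedHeckeAlgebra θ) (localizedEigenAugmentation θ) =
      heckeCongruenceIdeal θ :=
  congruenceIdeal_localizedAugmentation_eq_of_isNoetherianRing (T := FullHeckeAlgebra N k O)
    (eigenAugmentation θ) (LocalizedHeckeAlgebra θ)

end Local

/-! ### Sanity checks -/

section Instances

variable (N : ℕ) [NeZero N] (n : ℕ) (k : ℤ) (O : Type*) [CommRing O] [IsLocalRing O]

example (θ : heckeRing1 N (n + 2) →+* O) : IsLocalRing (LocalizedHeckeAlgebra θ) :=
  inferInstance
example (θ : heckeRing1 N (n + 2) →+* O) : Algebra O (LocalizedHeckeAlgebra θ) := inferInstance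
example (θ : heckeRing1 N k →+* O) :
    IsScalarTower O (FullHeckeAlgebra N k O) (LocalizedHeckeAlgebra θ) := inferInstance
example [IsNoetherianRing O] (θ : heckeRing1 N (n + 2) →+* O) :
    congruenceIdeal (localizedEigenAugmentation θ) = heckeCongruenceIdeal θ :=
  heckeCongruenceIdeal_eq_localized θ

end Instances

end Literature.NumberTheory.Automorphic

end
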